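import Mathlib.Analysis.SpecialFunctions.Pow.Real
import Summits.Ventures.PackingBounds.Configurations.DiploSimplexUnique
import Summits.Ventures.PackingBounds.Configurations.DiploSimplexEnergy
import HarnessLib
import HarnessLib.Audit.Tags

/-!
# Venture PackingBounds — Conjectures/DiploSimplexRiesz.lean: the diplo-simplex Riesz-energy conjectures A / B, TYPED

Framing: lottery ticket; floor = certified bounds/negative ranges. Venture `PackingBounds` (cell `pub-packcert`, seat
`pub-packcert-energy`, gen 26; lead ruling R29-1 (5), 2026-08-26T02:51Z: "Conjectures A / B (PAPER-diplo-g25 §18.3) ENTER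
the typing queue — ONE Lean module under `Summits/Ventures/PackingBounds/Conjectures/`, Prop defs + evidence ledger").
This file ASSERTS NOTHING: it types open, falsifiable statements as `@[conjecture] def … : Prop` over
`Finset (EuclideanSpace ℝ (Fin n))` / `rpow` exactly as in `Config.DiploSimplex.exists_config_dist`, plus cheap honest wiring
(the value is attained for every `n ≥ 2`; B ⇒ the harmonic conjecture in print; B ⇒ the inequality half of A). No `sorry`, no axiom.

OBJECT. `D_n ⊂ S^{n-1}`, the diplo-simplex: `±` a regular simplex, `2n + 2` points, distances `2` (once per point),
`√(2 + 2/n)` and `√(2 - 2/n)` (`n` times each). Riesz-`s` energy (ordered pairs) `E_s(C) = Σ_{x ≠ y ∈ C} ‖x - y‖^{-s}`, so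
`E_s(D_n) = (2n+2)(2^{-s} + n (2 + 2/n)^{-s/2} + n (2 - 2/n)^{-s/2})` (`dipValue`; kernel: `Config.DiploSimplex.exists_config_dist`).

IN PRINT. Ballinger–Blekherman–Cohn–Giansiracusa–Kelly–Schürmann 2009, §3.4 / §5 (numerical): the diplo-simplex is suboptimal for the
HARMONIC energy (`s = n - 2`) for `3 ≤ n ≤ 5` and "appears optimal for all other n"; "we can conjecture only one infinite family of
balanced harmonic optima with more than 2n points in ℝⁿ, namely the diplo-simplices with 2n+2 points in ℝⁿ for n ≥ 6"
(`BBCGKSHarmonic` below). Universal optimality is FALSE (ibid., Table 'balanced'; not even a locally optimal code, App. §7); optimality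
among ANTIPODAL configurations is classical (Cohn–Kumar 2007 §8, Cohn–Woo 2012 §5.2; kernel: `Energy/DiploSimplexAntipodal`, gen 26).

CERTIFIED INSTANCES (cell evidence, NOT Lean facts; PACK-TABLE §B4c 'E3PT-DIPLO', E3PT-diplo-g25.md §2): exact SHARP three-point
certificates (Cohn–Woo 2012 Thm 3.2 programs, SDP degree 8 unless marked, Hermite minorant (9; 2, 2), bound == `E_s(D_n)` exactly,
two independent readers) prove `DiploMinimises n s` — and, by Hermite strictness + `Config.DiploSimplexUnique`, `DiploRigid n s` — for
`s = 1`: `n = 8, 9, 10, 11, 12, 13, 14, 16, 20, 24`; `s = 2`: `n = 8` (degree 10), `9, …, 14, 16, 20, 24`; `s = 3`: `n = 10, …, 14, 16, 20`;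
`s = 4`: `n = 14, 16` (29 members at 2026-08-26T03:00Z). NEGATIVE / float evidence (E3PT-diplo-g25 §4, §7): the degree-8 program is
NOT float-sharp at `(32, 66)` `s = 1` (gap 6.6e-7), at `n = 6, 7` for any probed `s` (`(7,16)` `s = 1`: 1.0e-5 at d 8, 4.8e-7 at
d 10), nor for any harmonic case `s = n - 2` (gaps 2e-3 … 1e-2 at d 8), and it PLATEAUS strictly below `E_1(D_5)` at `(5, 12)`
(3.5e-4 at d 8 = d 10) although the 96-start numerical optimum of `(5, 12)`, `s = 1` IS `D_5`; numerical optima (64-start L-BFGS)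
equal `D_n` for every probed `(n, s)` with `n ≥ 6` (incl. the harmonic `(6,14)`, `(7,16)`, `(8,18)`) and for `(5,12)` `s = 1`, but NOT
for `(5,12)` `s = 2, 3`.

WHAT IS TYPED. `ConjectureA` (PAPER-diplo-g25 §18.3 A, degree-free form): for every `n ≥ 6` and `0 < s ≤ 1`, `D_n` minimises `E_s`
among `(2n+2)`-subsets of `S^{n-1}`, uniquely up to isometry (typed as: every minimiser has all inner products in `{-1, ±1/n}`, which by
`Config.DiploSimplexUnique.isometric_of_nodesets` is isometry to `D_n`). `ConjectureB` (§18.3 B, threshold form): for every `n ≥ 6`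
there is `s*(n) ≥ n - 2` with `D_n` minimising `E_s` for `0 < s ≤ s*(n)` and NOT minimising for `s > s*(n)`; `ConjectureB5`: the same
at `n = 5` with `1 ≤ s*(5) < 2`. NOT typed (meta-statements about SDP programs): "for each `(n, s)` in A some finite SDP degree of the
three-point bound proves it" and "no three-point bound of degree ≤ 10 is sharp at `(5, 12)`". WHAT WOULD REFUTE A/B: one
`(2n+2)`-configuration with energy below `dipValue n s` for some `n ≥ 6`, `s ≤ 1` (A) / a non-interval set of optimal `s` (B).
WHAT WOULD PROVE THEM: a parametric (in `n`, degree growing with `n`) three-point certificate — E3PT-diplo-g25 §7 shows a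
fixed-degree-8 certificate cannot exist for all `n`.

## References
* B. Ballinger, G. Blekherman, H. Cohn, N. Giansiracusa, E. Kelly, A. Schürmann, Experiment. Math. 18 (2009) 257–283, §3.4, §5,
  App. §7. [`BallingerEtAl2009`]
* H. Cohn, J. Woo, J. Amer. Math. Soc. 25 (2012) 929–958, Thm 3.2, §5.2. [`CohnWoo2012`]
* H. Cohn, A. Kumar, J. Amer. Math. Soc. 20 (2007) 99–148, §8. [`CohnKumar2006`]
-/

noncomputable section

open Finset
open scoped RealInnerProductSpace

namespace Summit.Ventures.PackingBounds.Conjectures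

/-- `E_s(D_n) = (2n+2)(2^{-s} + n √(2+2/n)^{-s} + n √(2-2/n)^{-s})`: the Riesz-`s` energy (ordered pairs) of the diplo-simplex of
`ℝⁿ` (`Config.DiploSimplex.exists_config_dist` with `g r = r^{-s}`). -/
def dipValue (n : ℕ) (s : ℝ) : ℝ :=
  (2 * n + 2 : ℝ) * ((2 : ℝ) ^ (-s) + n * Real.sqrt (2 + 2 / (n : ℝ)) ^ (-s) + n * Real.sqrt (2 - 2 / (n : ℝ)) ^ (-s))

/-- `D_n` MINIMISES the Riesz-`s` energy among `(2n+2)`-point configurations of `S^{n-1}`: every `2n+2` unit vectors of `ℝⁿ`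
have `Σ_{x ≠ y} ‖x - y‖^{-s} ≥ E_s(D_n)`. (Certified for the 29 members listed in the module docstring; conjectured in A/B.) -/
def DiploMinimises (n : ℕ) (s : ℝ) : Prop :=
  ∀ C : Finset (EuclideanSpace ℝ (Fin n)), C.card = 2 * n + 2 → (∀ x ∈ C, ‖x‖ = 1) →
    dipValue n s ≤ ∑ x ∈ C, ∑ y ∈ C.erase x, ‖x - y‖ ^ (-s)

/-- RIGIDITY of the minimum: every `(2n+2)`-point configuration of `S^{n-1}` with Riesz-`s` energy `≤ E_s(D_n)` has all pairwise
inner products in `{-1, -1/n, 1/n}` — hence (`Config.DiploSimplexUnique.isometric_of_nodesets`, `n ≥ 3`) is isometric to `D_n`. -/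
def DiploRigid (n : ℕ) (s : ℝ) : Prop :=
  ∀ C : Finset (EuclideanSpace ℝ (Fin n)), C.card = 2 * n + 2 → (∀ x ∈ C, ‖x‖ = 1) →
    ∑ x ∈ C, ∑ y ∈ C.erase x, ‖x - y‖ ^ (-s) ≤ dipValue n s →
    ∀ x ∈ C, ∀ y ∈ C, x ≠ y → inner ℝ x y = -1 ∨ inner ℝ x y = -1 / (n : ℝ) ∨ inner ℝ x y = 1 / (n : ℝ)

/-- **CONJECTURE A (diplo-simplex family, degree-free form; PAPER-diplo-g25 §18.3).** For every `n ≥ 6` and every `0 < s ≤ 1` the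
diplo-simplex is the unique (up to isometry) minimiser of the Riesz-`s` energy among `(2n+2)`-point subsets of `S^{n-1}`. OPEN;
certified by exact sharp three-point certificates for `s = 1`, `n ∈ {8,…,14, 16, 20, 24}` (cell PACK-TABLE §B4c); float evidence
and falsifier in the module docstring. Not a theorem. -/
@[conjecture] def ConjectureA : Prop :=
  ∀ n : ℕ, 6 ≤ n → ∀ s : ℝ, 0 < s → s ≤ 1 → DiploMinimises n s ∧ DiploRigid n s

/-- **CONJECTURE B (threshold form; PAPER-diplo-g25 §18.3).** For every `n ≥ 6` there is a threshold `s*(n) ≥ n - 2` such that, for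
`s > 0`, the diplo-simplex minimises the Riesz-`s` energy among `(2n+2)`-point subsets of `S^{n-1}` if and only if `s ≤ s*(n)`
(contains the BBCGKS harmonic conjecture `s = n - 2`; `D_n` is not even a locally optimal code, so large `s` fail). OPEN. -/
@[conjecture] def ConjectureB : Prop :=
  ∀ n : ℕ, 6 ≤ n → ∃ sStar : ℝ, (n : ℝ) - 2 ≤ sStar ∧ ∀ s : ℝ, 0 < s → (DiploMinimises n s ↔ s ≤ sStar)

/-- **CONJECTURE B₅ (the `n = 5` clause of PAPER-diplo-g25 §18.3 B).** There is `1 ≤ s*(5) < 2` such that, for `s > 0`, `D_5`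
(12 points of `S⁴`) minimises the Riesz-`s` energy among 12-point subsets of `S⁴` iff `s ≤ s*(5)` (numerics: `D_5` is the apparent
optimum at `s = 1/2, 1`, not at `s = 2, 3`; BBCGKS: suboptimal for the harmonic `s = 3`). OPEN; no three-point bound of SDP
degree ≤ 10 is float-sharp at `(5, 12)` (plateau 3.5e-4 below `E_1(D_5)`), so a proof needs another method. -/
@[conjecture] def ConjectureB5 : Prop :=
  ∃ sStar : ℝ, 1 ≤ sStar ∧ sStar < 2 ∧ ∀ s : ℝ, 0 < s → (DiploMinimises 5 s ↔ s ≤ sStar)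

/-- **The BBCGKS harmonic conjecture (in print, numerical; Ballinger et al. 2009 §3.4 / §5):** for every `n ≥ 6` the diplo-simplex
minimises the HARMONIC energy `Σ_{x ≠ y} ‖x - y‖^{-(n-2)}` among `(2n+2)`-point subsets of `S^{n-1}`. OPEN (no member certified:
the degree-8 three-point bound is not sharp for any harmonic case). [cite: BallingerEtAl2009, §3.4] -/
@[conjecture] def BBCGKSHarmonic : Prop :=
  ∀ n : ℕ, 6 ≤ n → DiploMinimises n ((n : ℝ) - 2)

/-! ### Cheap honest wiring -/

/-- The conjectured minimum is ATTAINED (every `n ≥ 2`, every `s`): the diplo-simplex of `ℝⁿ` has Riesz-`s` energy `dipValue n s`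
(kernel, `Config.DiploSimplex.exists_config_dist`); so `DiploMinimises n s` says exactly that `dipValue n s` is the least energy. -/
theorem dipValue_attained (n : ℕ) (hn : 2 ≤ n) (s : ℝ) :
    ∃ C : Finset (EuclideanSpace ℝ (Fin n)), C.card = 2 * n + 2 ∧ (∀ x ∈ C, ‖x‖ = 1) ∧
      ∑ x ∈ C, ∑ y ∈ C.erase x, ‖x - y‖ ^ (-s) = dipValue n s := by
  obtain ⟨C, hc, h1, he⟩ := Config.DiploSimplex.exists_config_dist n hn
  exact ⟨C, hc, h1, by rw [he (fun r => r ^ (-s))]; rfl⟩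

/-- `DiploMinimises n s` (`n ≥ 2`) is equivalent to: `dipValue n s` is the LEAST Riesz-`s` energy of `2n+2` points of `S^{n-1}`. -/
theorem diploMinimises_iff_isLeast (n : ℕ) (hn : 2 ≤ n) (s : ℝ) :
    DiploMinimises n s ↔ IsLeast {E : ℝ | ∃ C : Finset (EuclideanSpace ℝ (Fin n)), C.card = 2 * n + 2 ∧
      (∀ x ∈ C, ‖x‖ = 1) ∧ E = ∑ x ∈ C, ∑ y ∈ C.erase x, ‖x - y‖ ^ (-s)} (dipValue n s) := by
  constructor
  · intro h
    refine ⟨?_, ?_⟩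
    · obtain ⟨C, hc, h1, he⟩ := dipValue_attained n hn s
      exact ⟨C, hc, h1, he.symm⟩
    · rintro E ⟨C, hc, h1, rfl⟩
      exact h C hc h1
  · rintro ⟨-, hlb⟩ C hc h1
    exact hlb ⟨C, hc, h1, rfl⟩

/-- Rigidity ⇒ uniqueness up to isometry (`n ≥ 3`): under `DiploRigid n s`, any two `(2n+2)`-point configurations of `S^{n-1}` with
Riesz-`s` energy `≤ dipValue n s` are isometric (kernel: `Config.DiploSimplexUnique.isometric_of_nodesets`). -/
theorem isometric_of_diploRigid {n : ℕ} (hn : 3 ≤ n) {s : ℝ} (h : DiploRigid n s)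
    (C C' : Finset (EuclideanSpace ℝ (Fin n))) (hc : C.card = 2 * n + 2) (h1 : ∀ x ∈ C, ‖x‖ = 1)
    (hE : ∑ x ∈ C, ∑ y ∈ C.erase x, ‖x - y‖ ^ (-s) ≤ dipValue n s)
    (hc' : C'.card = 2 * n + 2) (h1' : ∀ x ∈ C', ‖x‖ = 1)
    (hE' : ∑ x ∈ C', ∑ y ∈ C'.erase x, ‖x - y‖ ^ (-s) ≤ dipValue n s) :
    ∃ Ψ : EuclideanSpace ℝ (Fin n) ≃ₗᵢ[ℝ] EuclideanSpace ℝ (Fin n), C' = C.image Ψ :=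
  Config.DiploSimplexUnique.isometric_of_nodesets hn C C' h1 hc (h C hc h1 hE) h1' hc' (h C' hc' h1' hE')

/-- Conjecture B contains the harmonic conjecture in print (`s = n - 2 ≤ s*(n)`, and `n - 2 > 0` for `n ≥ 6`). -/
theorem bbcgksHarmonic_of_conjectureB (hB : ConjectureB) : BBCGKSHarmonic := by
  intro n hn
  obtain ⟨sStar, hge, hiff⟩ := hB n hn
  have hn6 : (6 : ℝ) ≤ n := by exact_mod_cast hn
  exact (hiff ((n : ℝ) - 2) (by linarith)).2 hge

/-- Conjecture B implies the inequality half of Conjecture A (`s ≤ 1 ≤ n - 2 ≤ s*(n)` for `n ≥ 6`). -/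
theorem diploMinimises_of_conjectureB (hB : ConjectureB) (n : ℕ) (hn : 6 ≤ n) (s : ℝ) (hs : 0 < s) (hs1 : s ≤ 1) :
    DiploMinimises n s := by
  obtain ⟨sStar, hge, hiff⟩ := hB n hn
  have hn6 : (6 : ℝ) ≤ n := by exact_mod_cast hn
  exact (hiff s hs).2 (by linarith)

end Summit.Ventures.PackingBounds.Conjectures

end
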